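import Summits.QuantumFields.QCD.Theses.SpectralDefectExtinction
import Summits.QuantumFields.QCD.Theorems.SpectralDefectExtinctionChiralDescentInfimumDescent
import Literature.MathematicalPhysics.QuantumFieldTheory.QCDGoldstoneBound
import Summits.QuantumFields.QCD.Theorems.ChiralDescent.Negative.DataLevelObstruction
import Summits.QuantumFields.QCD.Theses.QuarksAsStableAction

/-!
# Line `saturated-infimum` for crux `SpectralDefectExtinction.ChiralDescent`
# (item stmt-QuantumFields-17527, route route-QuantumFields-SpectralDefectExtinction; crux-strategist ALTERNATIVE line — its
# files sit next to the live line `Lines/Sketch.lean`; CAUTION: `ledger skeleton check` keeps ONE skeleton record per crux, so a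
# lead adopts this line only by registering this file itself at a cycle boundary — the strategist's one registration (02:54Z)
# displaced the lead's record and was repaired by lead c4's re-registration of its stubs at 02:57Z)

THE IDEA. The live line (infimum descent) takes `σ = inf S(reg)` of the body up-set of the threshold regularisation
and needs OPENNESS (stub H1): body + one uniform rate above `μ` ⇒ body above `μ − δ` ALONG THE SAME FULL SEQUENCE `k`.
Because `IsQCDAlong` asks for convergence along the whole sequence, any proof of H1 must deliver UNIQUENESS of the
continued continuum limit — which is why the lead's engine needs a Lee–Yang-type zero-free complex-mass region
(identity theorem / Vitali).  Constructive technology (multiscale RG) outputs BOUNDS, hence subsequential limits, never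
uniqueness; the Statement itself was typed "existence along a sequence, not uniqueness" for exactly this reason.

This line deletes the uniqueness requirement.  It enlarges the search space of witnesses from the `m_crit`-shifts of
`reg` to the shifts of ALL REINDEXINGS `reg.restrict φ` (`φ` strictly increasing), and replaces H1 by

* `stub_subseqOpennessInterior` (S3, the hard stub, STRICTLY WEAKER than H1): body + one uniform rate above `μ` ⇒ body
  above `μ − δ` along SOME FURTHER SUBSEQUENCE — a compactness statement (tightness + closedness of the body's clauses
  under subsequential limits + persistence of gap/non-triviality slightly below a uniformly gapped offset), with no
  analyticity and no identity theorem; stated for INTERIOR regularisations only (`∃ c > −1, ∀ᶠ k, c ≤ m_crit k`), so the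
  wall artefact of H1 (p136901) is not in it;

and pays for the enlarged witness space with pure order theory:

* `saturation` (S1, PROVED in this file, abstract): for any assignment `T` of a set of reals to each subsequence that is
  monotone under EVENTUAL REFINEMENT, there is a SATURATED subsequence `Φ` — `T Φ` reaches, within every `η > 0`, below
  every element of `T (Φ ∘ ψ)` for every further subsequence `ψ` (diagonal construction: refine so that `inf T` drops to
  within `1/n` of the infimum over all refinements, then diagonalise; eventual refinement is what the diagonal gives);
* `bodyEventualRefinement` (S2, PROVED in this file, bookkeeping): the body up-set grows under eventual refinement of
  the reindexing (limits pass to subsequences and ignore finitely many terms; the lattice Schwinger functions at step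
  `k` read only the scheme data at `k`: `qcdLatticeSchwinger_eq_schwingerOfData` is `rfl`, `qcdLatticeSchwinger_congr_data`);
* `stub_wallNoGo` (S5, corner no-go): a mass-scaling regularisation whose critical masses stay eventually below every
  `c > −1` (bare masses `→ −1⁺` or beyond: cutoff-mass quarks) carries the body above no offset — the decoupling no-go that
  H1 hides at walls, isolated; the glue reaches the interior case by extracting a subsequence with `m_crit ≥ c > −1`
  whenever one exists (`Filter.extraction_of_frequently_atTop`);
* `stub_chiralPointOfBodyEverywhere` (S4) — verbatim the live line's H2 (shared).

COMPOSITION (`ChiralDescent_of`, sorry-free; the ONLY sorries of the file are the three physics stubs S3, S4, S5):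
threshold `reg` ⇒ (S5) an interior subsequence `reg₀` carrying the threshold body (S2, proved) ⇒ (S1 `saturation`,
proved, with `T φ = S(reg₀.restrict φ)`, monotone by S2) a saturated `Φ`, `reg₁ := reg₀.restrict Φ`
⇒ either `S(reg₁) = ℝ` (then S4 gives a chiral offset) or `σ := inf S(reg₁)` is attained (`forall_above_csInf`,
p134498) and carries no uniform rate — a rate would let S3 put `σ − δ` into `S(reg₁.restrict ψ) = T (Φ ∘ ψ)`, and
saturation would pull an element of `S(reg₁)` below `σ`; the witness is the shift of `reg₁` by `σ`
(`qcdOf_of_bodyAbove_of_noUniformGapAbove`, p134498).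

RELATION TO EXISTING ITEMS (kernel-checked adapters in §3): S3 is implied by the live line's H1
(`subseqOpennessInterior_of_gaplessBodyInfimum`) AND by the existing item `QuarksAsStableAction.MassContinuation`
(stmt-QuantumFields-18327 = openness along the same sequence; `subseqOpennessInterior_of_massContinuation`), and S4 by the existing
item `QuarksAsStableAction.ChiralTupleGapless` (stmt-18328; `chiralPointOfBodyEverywhere_of_chiralTupleGapless`): the line's stubs
are WEAKER forms of statements already on the ledger, never new conjectures; whoever restates 18327 can file S3's signature.

DISPROOF USED (`Cruxes/ChiralDescent/Disproof.lean`, cdisprove FINAL, RESISTS): §3 — reindexings never CREATE the pin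
from threshold data under a uniform gap (`not_isChiralAtZero_of_eventuallyThresholdData`, `isChiralAtZero_of_restrict`):
honoured — chirality here is derived at the saturated infimum from S3 by contradiction, never transported along a
reindexing; §1 window / `FlavourGuard`: the guard enters at S4 (false at `N_f = 0`) and at the attained infimum
(`0 < N_f`); landed negatives `DataLevelObstruction`, `FlavourGuard`, wall no-go p136901 (now S5, explicit).
-/

namespace Summit.QuantumFields.QCD.Cruxes.ChiralDescent.SaturatedInfimum

open Filter Topology
open Literature.MathematicalPhysics.QuantumFieldTheory
open Summit.QuantumFields.QCD.Cruxes.ChiralDescent.InfimumDescent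

variable {Nf : ℕ}

/-! ## §1 S1 — saturation under eventual refinement (PROVED here, sorry-free: the line's new load-bearing logic) -/

/-- Iterated refinements: `rseq Ψ 0 = id`, `rseq Ψ (n+1) = rseq Ψ n ∘ Ψ n (rseq Ψ n)` (strictly increasing maps). [folklore] -/
noncomputable def rseq (Ψ : ℕ → {φ : ℕ → ℕ // StrictMono φ} → {φ : ℕ → ℕ // StrictMono φ}) :
    ℕ → {φ : ℕ → ℕ // StrictMono φ}
  | 0 => ⟨id, strictMono_id⟩
  | n + 1 => ⟨(rseq Ψ n).1 ∘ (Ψ n (rseq Ψ n)).1, (rseq Ψ n).2.comp (Ψ n (rseq Ψ n)).2⟩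

/-- The link maps: `rseq Ψ k = rseq Ψ n ∘ link Ψ n k` for `n ≤ k` (`link Ψ n k = id` for `k ≤ n`). [folklore] -/
noncomputable def link (Ψ : ℕ → {φ : ℕ → ℕ // StrictMono φ} → {φ : ℕ → ℕ // StrictMono φ}) (n : ℕ) :
    ℕ → (ℕ → ℕ)
  | 0 => id
  | k + 1 => if k + 1 ≤ n then id else link Ψ n k ∘ (Ψ k (rseq Ψ k)).1

section saturation

variable (Ψ : ℕ → {φ : ℕ → ℕ // StrictMono φ} → {φ : ℕ → ℕ // StrictMono φ})

theorem link_of_le {n k : ℕ} (h : k ≤ n) : link Ψ n k = id := by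
  cases k with
  | zero => rfl
  | succ k => simp [link, h]

theorem link_succ_of_lt {n k : ℕ} (h : n ≤ k) : link Ψ n (k + 1) = link Ψ n k ∘ (Ψ k (rseq Ψ k)).1 := by
  have : ¬ k + 1 ≤ n := by omega
  simp [link, this]

theorem strictMono_link (n : ℕ) : ∀ k, StrictMono (link Ψ n k)
  | 0 => strictMono_id
  | k + 1 => by
    by_cases h : k + 1 ≤ n
    · rw [link_of_le Ψ h]; exact strictMono_id
    · rw [link_succ_of_lt Ψ (by omega)]
      exact (strictMono_link n k).comp (Ψ k (rseq Ψ k)).2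

theorem rseq_eq_comp_link {n : ℕ} : ∀ {k}, n ≤ k → (rseq Ψ k).1 = (rseq Ψ n).1 ∘ link Ψ n k
  | 0, h => by
    obtain rfl : n = 0 := Nat.le_zero.mp h
    rfl
  | k + 1, h => by
    rcases Nat.lt_or_eq_of_le h with hlt | heq
    · have hnk : n ≤ k := Nat.lt_succ_iff.mp hlt
      rw [link_succ_of_lt Ψ hnk, ← Function.comp_assoc, ← rseq_eq_comp_link hnk]
      rfl
    · subst heq
      rw [link_of_le Ψ le_rfl]
      rfl

/-- The diagonal reindexing along `rseq Ψ n`: `didx Ψ n k = link Ψ n k k`. [folklore] -/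
noncomputable def didx (n k : ℕ) : ℕ := link Ψ n k k

theorem strictMono_didx (n : ℕ) : StrictMono (didx Ψ n) := by
  refine strictMono_nat_of_lt_succ fun k => ?_
  show link Ψ n k k < link Ψ n (k + 1) (k + 1)
  by_cases h : k + 1 ≤ n
  · rw [link_of_le Ψ h, link_of_le Ψ (by omega : k ≤ n)]
    exact Nat.lt_succ_self k
  · rw [link_succ_of_lt Ψ (by omega : n ≤ k)]
    show link Ψ n k k < link Ψ n k ((Ψ k (rseq Ψ k)).1 (k + 1))
    exact (strictMono_link Ψ n k) (lt_of_lt_of_le (Nat.lt_succ_self k) ((Ψ k (rseq Ψ k)).2.id_le (k + 1)))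

/-- The diagonal sequence `k ↦ rseq Ψ k k` is, from index `n` on, the reindexing of `rseq Ψ n` along `didx Ψ n`. [folklore] -/
theorem diag_eq {n k : ℕ} (h : n ≤ k) : (rseq Ψ k).1 k = (rseq Ψ n).1 (didx Ψ n k) := by
  have := congrFun (rseq_eq_comp_link Ψ h) k
  simpa [didx] using this

end saturation

/-- **S1 — SATURATION UNDER EVENTUAL REFINEMENT (PROVED, sorry-free; pure order theory / diagonal argument — the line's new load-bearing logic).**  Let `T` assign a
set of reals to every `φ : ℕ → ℕ`, monotonically under eventual refinement among strictly increasing maps: if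
`φ' k = φ (ψ k)` for all large `k` then `T φ ⊆ T φ'`.  Then some strictly increasing `Φ` is SATURATED: for every strictly
increasing `ψ`, every `μ ∈ T (Φ ∘ ψ)` and every `η > 0` there is `ν ∈ T Φ` with `ν < μ + η`.  Proof: `φ₀ = id`; given
`φₙ`, let `Lₙ = ⋃_ψ T (φₙ ∘ ψ)` and pick `ψₙ`, `μ' ∈ T (φₙ ∘ ψₙ)` with `μ' < max (μ + 1/(n+1)) (−n)` for all `μ ∈ Lₙ`
(`exists_lt_of_csInf_lt`, or unboundedness); `φₙ₊₁ = φₙ ∘ ψₙ`; the diagonal `Φ k = φ_k k` is strictly increasing and for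
each `n` EVENTUALLY a refinement of `φₙ` (`Φ k = φₙ (didx n k)` for `k ≥ n`), whence `T φₙ₊₁ ⊆ T Φ` and `T (Φ ∘ ψ) ⊆ Lₙ`
for all `n`; choose `n` with `1/(n+1) < η` and `−n ≤ μ + η`. [folklore] -/
theorem saturation (T : (ℕ → ℕ) → Set ℝ)
    (hT : ∀ φ φ' ψ : ℕ → ℕ, StrictMono φ → StrictMono φ' → StrictMono ψ →
      (∀ᶠ k in atTop, φ' k = φ (ψ k)) → T φ ⊆ T φ') :
    ∃ Φ : ℕ → ℕ, StrictMono Φ ∧ ∀ ψ : ℕ → ℕ, StrictMono ψ →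
      ∀ μ ∈ T (Φ ∘ ψ), ∀ η > (0 : ℝ), ∃ ν ∈ T Φ, ν < μ + η := by
  classical
  -- one refinement step
  have step : ∀ (n : ℕ) (φ : {φ : ℕ → ℕ // StrictMono φ}), ∃ ψ : {φ : ℕ → ℕ // StrictMono φ},
      ∀ μ : ℝ, (∃ ρ : ℕ → ℕ, StrictMono ρ ∧ μ ∈ T (φ.1 ∘ ρ)) →
        ∃ μ' ∈ T (φ.1 ∘ ψ.1), μ' < max (μ + 1 / ((n : ℝ) + 1)) (-(n : ℝ)) := by
    intro n φ
    set L : Set ℝ := {μ : ℝ | ∃ ρ : ℕ → ℕ, StrictMono ρ ∧ μ ∈ T (φ.1 ∘ ρ)} with hL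
    by_cases hne : L.Nonempty
    · by_cases hb : BddBelow L
      · have hpos : (0 : ℝ) < 1 / ((n : ℝ) + 1) := by positivity
        obtain ⟨μ₀, hμ₀L, hμ₀lt⟩ := exists_lt_of_csInf_lt hne (lt_add_of_pos_right (sInf L) hpos)
        obtain ⟨ρ₀, hρ₀, hμ₀T⟩ := hμ₀L
        refine ⟨⟨ρ₀, hρ₀⟩, fun μ hμ => ⟨μ₀, hμ₀T, ?_⟩⟩
        have hle : sInf L ≤ μ := csInf_le hb hμ
        exact lt_of_lt_of_le (by linarith) (le_max_left _ _)
      · rw [bddBelow_def] at hb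
        push Not at hb
        obtain ⟨μ₀, hμ₀L, hμ₀lt⟩ := hb (-(n : ℝ))
        obtain ⟨ρ₀, hρ₀, hμ₀T⟩ := hμ₀L
        exact ⟨⟨ρ₀, hρ₀⟩, fun μ _ => ⟨μ₀, hμ₀T, lt_of_lt_of_le hμ₀lt (le_max_right _ _)⟩⟩
    · refine ⟨⟨id, strictMono_id⟩, fun μ hμ => ?_⟩
      exact absurd ⟨μ, hμ⟩ hne
  choose Ψ hΨ using step
  -- the diagonal of the iterated refinements
  refine ⟨fun k => (rseq Ψ k).1 k, ?_, ?_⟩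
  · -- strictly increasing: it is `didx Ψ 0`
    have heq : (fun k => (rseq Ψ k).1 k) = didx Ψ 0 := funext fun k => diag_eq Ψ (Nat.zero_le k)
    rw [heq]
    exact strictMono_didx Ψ 0
  · intro ψ hψ μ hμ η hη
    have hΦ : StrictMono (fun k => (rseq Ψ k).1 k) := by
      have heq : (fun k => (rseq Ψ k).1 k) = didx Ψ 0 := funext fun k => diag_eq Ψ (Nat.zero_le k)
      rw [heq]
      exact strictMono_didx Ψ 0
    -- `μ` lies in `Lₙ` for every `n`
    have hμL : ∀ n : ℕ, ∃ ρ : ℕ → ℕ, StrictMono ρ ∧ μ ∈ T ((rseq Ψ n).1 ∘ ρ) := by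
      intro n
      refine ⟨didx Ψ n ∘ ψ, (strictMono_didx Ψ n).comp hψ, ?_⟩
      refine hT ((fun k => (rseq Ψ k).1 k) ∘ ψ) ((rseq Ψ n).1 ∘ (didx Ψ n ∘ ψ)) id (hΦ.comp hψ)
        ((rseq Ψ n).2.comp ((strictMono_didx Ψ n).comp hψ)) strictMono_id ?_ hμ
      filter_upwards [eventually_ge_atTop n] with k hk
      have hk' : n ≤ ψ k := le_trans hk (hψ.id_le k)
      simp only [Function.comp_apply, id_eq]
      exact (diag_eq Ψ hk').symm
    -- choose the level `n`
    obtain ⟨n, hn⟩ := exists_nat_ge (max (1 / η) (-(μ + η)))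
    have hn1 : 1 / η ≤ n := le_trans (le_max_left _ _) hn
    have hn2 : -(μ + η) ≤ n := le_trans (le_max_right _ _) hn
    have hηn : 1 / ((n : ℝ) + 1) < η := by
      rw [div_lt_iff₀ (by positivity)]
      have : 1 ≤ η * n := by
        have := mul_le_mul_of_nonneg_left hn1 hη.le
        rwa [mul_one_div_cancel hη.ne'] at this
      nlinarith
    obtain ⟨μ', hμ'T, hμ'lt⟩ := hΨ n (rseq Ψ n) μ (hμL n)
    -- `T (rseq Ψ (n+1)) ⊆ T Φ`
    have hsub : T ((rseq Ψ n).1 ∘ (Ψ n (rseq Ψ n)).1) ⊆ T (fun k => (rseq Ψ k).1 k) := by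
      refine hT _ _ (didx Ψ (n + 1)) (rseq Ψ (n + 1)).2 hΦ (strictMono_didx Ψ (n + 1)) ?_
      filter_upwards [eventually_ge_atTop (n + 1)] with k hk
      exact diag_eq Ψ hk
    refine ⟨μ', hsub hμ'T, lt_of_lt_of_le hμ'lt (max_le (by linarith) (by linarith))⟩

/-! ## §2 S2 — the body up-set grows under eventual refinement (PROVED here, sorry-free: finite modifications of the
cutoff sequence are invisible to `IsQCDAlong` and to the gap clause) -/

open scoped SchwartzMap in
open Literature.MathematicalPhysics.QuantumLattice Literature.Probability.LatticeModels in
/-- The lattice QCD `n`-point function at one step as a function of the bare DATA `(L, a, β, m_f, z, shift)` at that step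
(the body of `qcdLatticeSchwinger` with the scheme projections replaced by plain arguments). [folklore] -/
noncomputable def schwingerOfData (L : ℕ) (a β : ℝ) (mq : Fin Nf → ℝ) (z sh : QCDField Nf → ℝ) (n : ℕ)
    (σ : Fin n → QCDField Nf) (f : Fin n → 𝓢(EuclideanSpace ℝ (Fin 4), ℝ)) : ℂ :=
  (∫ U : GaugeConfig 4 (2 * L + 1) ↥(Matrix.specialUnitaryGroup (Fin 3) ℂ),
      fermiIntegral ((List.ofFn fun i =>
        (∑ x ∈ box 4 L, ((z (σ i) * a ^ 4 * f i (a • siteToE x) : ℝ) : ℂ) •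
            (insertion U (σ i) x - algebraMap ℂ _ ((sh (σ i) : ℝ) : ℂ)))).prod *
        fermiBoltzmann U mq)
      ∂(wilsonMeasure (d := 4) (L := 2 * L + 1) (fundamentalRep (Fin 3)) β)) /
    ∫ U : GaugeConfig 4 (2 * L + 1) ↥(Matrix.specialUnitaryGroup (Fin 3) ℂ),
      fermiIntegral (fermiBoltzmann U mq)
      ∂(wilsonMeasure (d := 4) (L := 2 * L + 1) (fundamentalRep (Fin 3)) β)

open scoped SchwartzMap in
/-- `qcdLatticeSchwinger sch k` reads only the data of `sch` at step `k`. [folklore] -/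
theorem qcdLatticeSchwinger_eq_schwingerOfData (sch : QCDScheme Nf) (k n : ℕ) (σ : Fin n → QCDField Nf)
    (f : Fin n → 𝓢(EuclideanSpace ℝ (Fin 4), ℝ)) :
    qcdLatticeSchwinger sch k n σ f =
      schwingerOfData (sch.L k) (sch.a k) (sch.β k) (fun fl => sch.mq fl k) (fun s => sch.z s k)
        (fun s => sch.shift s k) n σ f :=
  rfl

open scoped SchwartzMap in
/-- **Data congruence**: two schemes with the same data at steps `k'`, `k` have the same lattice `n`-point functions there. [folklore] -/
theorem qcdLatticeSchwinger_congr_data {sch sch' : QCDScheme Nf} {k k' : ℕ} (hL : sch'.L k' = sch.L k)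
    (ha : sch'.a k' = sch.a k) (hβ : sch'.β k' = sch.β k) (hmq : ∀ fl, sch'.mq fl k' = sch.mq fl k)
    (hz : ∀ s, sch'.z s k' = sch.z s k) (hsh : ∀ s, sch'.shift s k' = sch.shift s k) (n : ℕ)
    (σ : Fin n → QCDField Nf) (f : Fin n → 𝓢(EuclideanSpace ℝ (Fin 4), ℝ)) :
    qcdLatticeSchwinger sch' k' n σ f = qcdLatticeSchwinger sch k n σ f := by
  rw [qcdLatticeSchwinger_eq_schwingerOfData, qcdLatticeSchwinger_eq_schwingerOfData, hL, ha, hβ,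
    funext hmq, funext hz, funext hsh]

/-- `IsQCDAlong` transfers along eventually-equal reindexed data (species renormalisations reindexed by `ψ`). [folklore] -/
theorem isQCDAlong_of_eventually_data {sch sch' : QCDScheme Nf} {ψ : ℕ → ℕ} (hψ : Tendsto ψ atTop atTop)
    (hdata : ∀ᶠ k in atTop, sch'.L k = sch.L (ψ k) ∧ sch'.a k = sch.a (ψ k) ∧ sch'.β k = sch.β (ψ k) ∧
      (∀ fl, sch'.mq fl k = sch.mq fl (ψ k)) ∧ (∀ s, sch'.z s k = sch.z s (ψ k)) ∧
        ∀ s, sch'.shift s k = sch.shift s (ψ k))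
    {T : OSData (QCDField Nf) 4} (h : IsQCDAlong sch T) : IsQCDAlong sch' T := by
  obtain ⟨⟨Λ, hΛ, hAS⟩, hbr, hconv⟩ := h
  refine ⟨⟨Λ, hΛ, ?_⟩, fun fl => ?_, fun n hn σ f F hF hoff => ?_⟩
  · refine (hAS.comp hψ).congr' ?_
    filter_upwards [hdata] with k hk
    obtain ⟨-, ha, hβ, -⟩ := hk
    simp only [Function.comp_apply, ha, hβ]
  · filter_upwards [hψ.eventually (hbr fl), hdata] with k hk hd
    obtain ⟨-, -, -, hmq, -⟩ := hd
    rw [hmq fl]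
    exact hk
  · refine ((hconv n hn σ f F hF hoff).comp hψ).congr' ?_
    filter_upwards [hdata] with k hk
    obtain ⟨hL, ha, hβ, hmq, hz, hsh⟩ := hk
    exact (qcdLatticeSchwinger_congr_data hL ha hβ hmq hz hsh n σ f).symm

/-- **S2 — THE BODY UP-SET GROWS UNDER EVENTUAL REFINEMENT OF THE REINDEXING (PROVED, sorry-free; bookkeeping).**  If
`φ' k = φ (ψ k)` for all large `k` (`φ, φ', ψ` strictly increasing) and every tuple above `μ` carries the body along
`reg.restrict φ`, then every tuple above `μ` carries it along `reg.restrict φ'`: `IsQCDAlong`'s three clauses are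
`Tendsto`/`∀ᶠ` statements in `k` reading only the scheme data at step `k` (compose the species renormalisations with
`ψ`; `qcdLatticeSchwinger_congr_data`), the OS data `T` and its gap are unchanged, `HasLatticeMassGap` is an `∀ᶠ k`
clause (`Negative.hasLatticeMassGap_of_eventually_comp`). [folklore] -/
theorem bodyEventualRefinement : ∀ (Nf : ℕ) (reg : QCDRegularisation Nf) (φ φ' ψ : ℕ → ℕ)
    (hφ : StrictMono φ) (hφ' : StrictMono φ') (_hψ : StrictMono ψ), (∀ᶠ k in atTop, φ' k = φ (ψ k)) → ∀ μ : ℝ,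
    (∀ m : Fin Nf → ℝ, (∀ f, μ < m f) →
      ∃ (z shift : QCDField Nf → ℕ → ℝ) (T : OSData (QCDField Nf) 4),
        IsQCDAlong ((reg.restrict φ hφ.tendsto_atTop).scheme m z shift) T ∧ T.IsNontrivial QCDField.glue ∧
          T.IsNonGaussian QCDField.glue ∧ (∀ f g : Fin Nf, f ≠ g → T.IsNontrivial (QCDField.pseudoRe f g)) ∧
            ∃ Δ > 0, T.HasMassGap Δ ∧ ((reg.restrict φ hφ.tendsto_atTop).scheme m z shift).HasLatticeMassGap Δ) →
    ∀ m : Fin Nf → ℝ, (∀ f, μ < m f) →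
      ∃ (z shift : QCDField Nf → ℕ → ℝ) (T : OSData (QCDField Nf) 4),
        IsQCDAlong ((reg.restrict φ' hφ'.tendsto_atTop).scheme m z shift) T ∧ T.IsNontrivial QCDField.glue ∧
          T.IsNonGaussian QCDField.glue ∧ (∀ f g : Fin Nf, f ≠ g → T.IsNontrivial (QCDField.pseudoRe f g)) ∧
            ∃ Δ > 0, T.HasMassGap Δ ∧ ((reg.restrict φ' hφ'.tendsto_atTop).scheme m z shift).HasLatticeMassGap Δ := by
  intro Nf reg φ φ' ψ hφ hφ' hψ hev μ hbody m hm
  obtain ⟨z, sh, T, hQ, hN, hG, hP, Δ, hΔ, hT, hL⟩ := hbody m hm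
  have hdata : ∀ᶠ k in atTop,
      ((reg.restrict φ' hφ'.tendsto_atTop).scheme m (fun s k => z s (ψ k)) (fun s k => sh s (ψ k))).L k =
          ((reg.restrict φ hφ.tendsto_atTop).scheme m z sh).L (ψ k) ∧
        ((reg.restrict φ' hφ'.tendsto_atTop).scheme m (fun s k => z s (ψ k)) (fun s k => sh s (ψ k))).a k =
          ((reg.restrict φ hφ.tendsto_atTop).scheme m z sh).a (ψ k) ∧
        ((reg.restrict φ' hφ'.tendsto_atTop).scheme m (fun s k => z s (ψ k)) (fun s k => sh s (ψ k))).β k =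
          ((reg.restrict φ hφ.tendsto_atTop).scheme m z sh).β (ψ k) ∧
        (∀ fl, ((reg.restrict φ' hφ'.tendsto_atTop).scheme m (fun s k => z s (ψ k)) (fun s k => sh s (ψ k))).mq fl k =
          ((reg.restrict φ hφ.tendsto_atTop).scheme m z sh).mq fl (ψ k)) ∧
        (∀ s, ((reg.restrict φ' hφ'.tendsto_atTop).scheme m (fun s k => z s (ψ k)) (fun s k => sh s (ψ k))).z s k =
          ((reg.restrict φ hφ.tendsto_atTop).scheme m z sh).z s (ψ k)) ∧
        ∀ s, ((reg.restrict φ' hφ'.tendsto_atTop).scheme m (fun s k => z s (ψ k)) (fun s k => sh s (ψ k))).shift s k =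
          ((reg.restrict φ hφ.tendsto_atTop).scheme m z sh).shift s (ψ k) := by
    filter_upwards [hev] with k hk
    refine ⟨?_, ?_, ?_, fun fl => ?_, fun s => rfl, fun s => rfl⟩
    · change reg.L (φ' k) = reg.L (φ (ψ k)); rw [hk]
    · change reg.a (φ' k) = reg.a (φ (ψ k)); rw [hk]
    · change reg.β (φ' k) = reg.β (φ (ψ k)); rw [hk]
    · change reg.mcrit (φ' k) + reg.a (φ' k) * m fl / reg.Zm (φ' k) =
        reg.mcrit (φ (ψ k)) + reg.a (φ (ψ k)) * m fl / reg.Zm (φ (ψ k)); rw [hk]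
  refine ⟨fun s k => z s (ψ k), fun s k => sh s (ψ k), T,
    isQCDAlong_of_eventually_data hψ.tendsto_atTop hdata hQ, hN, hG, hP, Δ, hΔ, hT, ?_⟩
  refine Summit.QuantumFields.QCD.Theorems.ChiralDescent.Negative.hasLatticeMassGap_of_eventually_comp
    hψ.tendsto_atTop ?_ hL
  filter_upwards [hdata] with k hk
  obtain ⟨hL', ha, hβ, hmq, -, -⟩ := hk
  exact ⟨hβ, hL', ha, hmq⟩

/-! ## §2b The REGISTERED STUBS — exactly three, all physics: S3 (hard, new), S4 (= the live line's H2), S5 (wall corner) -/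

/-- **S3 — SUBSEQUENTIAL OPENNESS AT A UNIFORMLY GAPPED OFFSET, INTERIOR REGULARISATIONS (the hard stub; conjecture
class, strictly weaker than the live line's H1).**  For `N_f ∈ {2,3}` and a mass-scaling regularisation whose critical
masses stay eventually above some `c > −1`: if every tuple above `μ` carries the body and ONE lattice rate `ε > 0` holds
at every tuple above `μ`, then for some `δ > 0` and SOME strictly increasing `ψ` every tuple above `μ − δ` carries the
body along `reg.restrict ψ`.  Content: light-quark continuation below a uniformly gapped offset by COMPACTNESS — tightness
of the lattice Schwinger functions in `k`, closedness of OS axioms / non-Gaussianity / non-decoupling / both gap clauses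
under subsequential limits, and persistence of a (smaller) gap slightly below `μ`; no uniqueness of the limit, no
analyticity in the mass.  Physically H1's "no first-order wall at positive mass in `θ = 0` QCD". [folklore] -/
theorem stub_subseqOpennessInterior : ∀ Nf : ℕ, (Nf = 2 ∨ Nf = 3) → ∀ reg : QCDRegularisation Nf,
    reg.HasMassScaling → (∃ c : ℝ, -1 < c ∧ ∀ᶠ k in atTop, c ≤ reg.mcrit k) → ∀ μ : ℝ,
    (∀ m : Fin Nf → ℝ, (∀ f, μ < m f) →
      ∃ (z shift : QCDField Nf → ℕ → ℝ) (T : OSData (QCDField Nf) 4),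
        IsQCDAlong (reg.scheme m z shift) T ∧ T.IsNontrivial QCDField.glue ∧ T.IsNonGaussian QCDField.glue ∧
          (∀ f g : Fin Nf, f ≠ g → T.IsNontrivial (QCDField.pseudoRe f g)) ∧
            ∃ Δ > 0, T.HasMassGap Δ ∧ (reg.scheme m z shift).HasLatticeMassGap Δ) →
    (∃ ε > (0 : ℝ), ∀ m : Fin Nf → ℝ, (∀ f, μ < m f) → (reg.scheme m 0 0).HasLatticeMassGap ε) →
    ∃ δ > (0 : ℝ), ∃ ψ : ℕ → ℕ, ∃ hψ : StrictMono ψ, ∀ m : Fin Nf → ℝ, (∀ f, μ - δ < m f) →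
      ∃ (z shift : QCDField Nf → ℕ → ℝ) (T : OSData (QCDField Nf) 4),
        IsQCDAlong ((reg.restrict ψ hψ.tendsto_atTop).scheme m z shift) T ∧ T.IsNontrivial QCDField.glue ∧
          T.IsNonGaussian QCDField.glue ∧ (∀ f g : Fin Nf, f ≠ g → T.IsNontrivial (QCDField.pseudoRe f g)) ∧
            ∃ Δ > 0, T.HasMassGap Δ ∧ ((reg.restrict ψ hψ.tendsto_atTop).scheme m z shift).HasLatticeMassGap Δ := by
  sorry

/-- **S4 — A BODY AT EVERY REAL TUPLE HAS A CHIRAL OFFSET (verbatim the live line's H2 `stub_chiralPointOfBodyEverywhere`;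
conjecture class, a no-go in disguise; engines `stub_noAnalyticAnomaly` p134287 / `stub_goldstoneFluxBound` p134184).**
[folklore] -/
theorem stub_chiralPointOfBodyEverywhere :
    ∀ Nf : ℕ, (Nf = 2 ∨ Nf = 3) → ∀ reg : QCDRegularisation Nf, reg.HasMassScaling →
      (∀ m : Fin Nf → ℝ,
        ∃ (z shift : QCDField Nf → ℕ → ℝ) (T : OSData (QCDField Nf) 4),
          IsQCDAlong (reg.scheme m z shift) T ∧ T.IsNontrivial QCDField.glue ∧ T.IsNonGaussian QCDField.glue ∧
            (∀ f g : Fin Nf, f ≠ g → T.IsNontrivial (QCDField.pseudoRe f g)) ∧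
              ∃ Δ > 0, T.HasMassGap Δ ∧ (reg.scheme m z shift).HasLatticeMassGap Δ) →
      ∃ μ : ℝ, ∀ ε > (0 : ℝ), ∃ m : Fin Nf → ℝ, (∀ f, μ < m f) ∧ ¬ (reg.scheme m 0 0).HasLatticeMassGap ε := by
  sorry

/-- **S5 — THE WALL NO-GO (corner; conjecture class in the decoupling regime, trivial by the branch clause beyond it).**
For `N_f ∈ {2,3}` and a mass-scaling regularisation whose critical masses are eventually below every `c > −1` (bare
masses of every fixed tuple `→ −1⁺` in the limit, or `≤ −1` frequently), no offset `μ` has the body at every tuple above it: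
beyond the wall the branch clause of `IsQCDAlong` fails outright; AT the wall (`m_crit(k) → −1`, hopping parameter
`→ 1/6⁻`) all sixteen Wilson species sit at cutoff mass, the flavour-changing pseudoscalars have no non-trivial OS limit
and the non-decoupling clause fails (expected; cf. `openness_denies_gapped_body_at_wall`, p136901). [folklore] -/
theorem stub_wallNoGo : ∀ Nf : ℕ, (Nf = 2 ∨ Nf = 3) → ∀ reg : QCDRegularisation Nf, reg.HasMassScaling →
    (∀ c : ℝ, -1 < c → ∀ᶠ k in atTop, reg.mcrit k < c) → ∀ μ : ℝ,
    ¬ ∀ m : Fin Nf → ℝ, (∀ f, μ < m f) →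
      ∃ (z shift : QCDField Nf → ℕ → ℝ) (T : OSData (QCDField Nf) 4),
        IsQCDAlong (reg.scheme m z shift) T ∧ T.IsNontrivial QCDField.glue ∧ T.IsNonGaussian QCDField.glue ∧
          (∀ f g : Fin Nf, f ≠ g → T.IsNontrivial (QCDField.pseudoRe f g)) ∧
            ∃ Δ > 0, T.HasMassGap Δ ∧ (reg.scheme m z shift).HasLatticeMassGap Δ := by
  sorry

/-! ## §3 Sorry-free bookkeeping -/

/-- Mass scaling (which reads only `a, Z_m`) passes to every reindexing `φ → ∞`. [folklore] -/
theorem hasMassScaling_restrict (reg : QCDRegularisation Nf) (φ : ℕ → ℕ) (hφ : Tendsto φ atTop atTop)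
    (h : reg.HasMassScaling) : (reg.restrict φ hφ).HasMassScaling := by
  obtain ⟨c, hc, ht⟩ := h
  exact ⟨c, hc, ht.comp hφ⟩

/-- Reindexing by the identity changes nothing. [folklore] -/
theorem restrict_id (reg : QCDRegularisation Nf) (h : Tendsto id atTop atTop) : reg.restrict id h = reg := by
  cases reg
  rfl

/-- Reindexing twice is reindexing by the composite. [folklore] -/
theorem restrict_restrict (reg : QCDRegularisation Nf) (φ ψ : ℕ → ℕ) (hφ : Tendsto φ atTop atTop)
    (hψ : Tendsto ψ atTop atTop) (hφψ : Tendsto (φ ∘ ψ) atTop atTop) :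
    (reg.restrict φ hφ).restrict ψ hψ = reg.restrict (φ ∘ ψ) hφψ :=
  rfl

/-- Plain heredity of the body above an offset, from `reg` to any subsequence (S2 with `φ = id`). [folklore] -/
theorem bodyAbove_restrict (reg : QCDRegularisation Nf) (φ : ℕ → ℕ) (hφ : StrictMono φ) (μ : ℝ)
    (h : ∀ m : Fin Nf → ℝ, (∀ f, μ < m f) →
      ∃ (z shift : QCDField Nf → ℕ → ℝ) (T : OSData (QCDField Nf) 4),
        IsQCDAlong (reg.scheme m z shift) T ∧ T.IsNontrivial QCDField.glue ∧ T.IsNonGaussian QCDField.glue ∧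
          (∀ f g : Fin Nf, f ≠ g → T.IsNontrivial (QCDField.pseudoRe f g)) ∧
            ∃ Δ > 0, T.HasMassGap Δ ∧ (reg.scheme m z shift).HasLatticeMassGap Δ) :
    ∀ m : Fin Nf → ℝ, (∀ f, μ < m f) →
      ∃ (z shift : QCDField Nf → ℕ → ℝ) (T : OSData (QCDField Nf) 4),
        IsQCDAlong ((reg.restrict φ hφ.tendsto_atTop).scheme m z shift) T ∧ T.IsNontrivial QCDField.glue ∧
          T.IsNonGaussian QCDField.glue ∧ (∀ f g : Fin Nf, f ≠ g → T.IsNontrivial (QCDField.pseudoRe f g)) ∧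
            ∃ Δ > 0, T.HasMassGap Δ ∧ ((reg.restrict φ hφ.tendsto_atTop).scheme m z shift).HasLatticeMassGap Δ := by
  have h' := h
  rw [← restrict_id reg strictMono_id.tendsto_atTop] at h'
  exact bodyEventualRefinement Nf reg id φ φ strictMono_id hφ hφ (Eventually.of_forall fun _ => rfl) μ h'

/-- A gapless minimum gives OPENNESS (pure logic on a per-tuple property `P` and a rate predicate `G`). [folklore] -/
theorem openness_of_gaplessInfimum (P : (Fin Nf → ℝ) → Prop) (G : ℝ → (Fin Nf → ℝ) → Prop)
    (h1 : ∀ μ : ℝ, (∀ m : Fin Nf → ℝ, (∀ f, μ < m f) → P m) →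
      (∀ μ' < μ, ¬ ∀ m : Fin Nf → ℝ, (∀ f, μ' < m f) → P m) →
      ∀ ε > (0 : ℝ), ∃ m : Fin Nf → ℝ, (∀ f, μ < m f) ∧ ¬ G ε m)
    (μ : ℝ) (hB : ∀ m : Fin Nf → ℝ, (∀ f, μ < m f) → P m)
    (hG : ∃ ε > (0 : ℝ), ∀ m : Fin Nf → ℝ, (∀ f, μ < m f) → G ε m) :
    ∃ δ > (0 : ℝ), ∀ m : Fin Nf → ℝ, (∀ f, μ - δ < m f) → P m := by
  by_contra hno
  push Not at hno
  obtain ⟨ε, hε, hgap⟩ := hG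
  have hmin : ∀ μ' < μ, ¬ ∀ m : Fin Nf → ℝ, (∀ f, μ' < m f) → P m := by
    intro μ' hμ' hall
    obtain ⟨m, hm, hPm⟩ := hno (μ - μ') (sub_pos.mpr hμ')
    exact hPm (hall m fun f => by linarith [hm f])
  obtain ⟨m, hm, hng⟩ := h1 μ hB hmin ε hε
  exact hng (hgap m hm)

/-- **S3 is implied by the live line's H1** (`stub_gaplessBodyInfimum` of `Lines/Sketch.lean`, stated here verbatim as a
hypothesis): H1 gives openness along the SAME sequence (pure logic), which is subsequential openness with `ψ = id`.  So S3 is a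
WEAKENING of the live hard stub (and drops its wall regime), never a strengthening. [folklore] -/
theorem subseqOpennessInterior_of_gaplessBodyInfimum
    (h1 : ∀ Nf : ℕ, (Nf = 2 ∨ Nf = 3) → ∀ reg : QCDRegularisation Nf, reg.HasMassScaling → ∀ μ : ℝ,
      (∀ m : Fin Nf → ℝ, (∀ f, μ < m f) →
        ∃ (z shift : QCDField Nf → ℕ → ℝ) (T : OSData (QCDField Nf) 4),
          IsQCDAlong (reg.scheme m z shift) T ∧ T.IsNontrivial QCDField.glue ∧ T.IsNonGaussian QCDField.glue ∧
            (∀ f g : Fin Nf, f ≠ g → T.IsNontrivial (QCDField.pseudoRe f g)) ∧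
              ∃ Δ > 0, T.HasMassGap Δ ∧ (reg.scheme m z shift).HasLatticeMassGap Δ) →
      (∀ μ' < μ, ¬ ∀ m : Fin Nf → ℝ, (∀ f, μ' < m f) →
        ∃ (z shift : QCDField Nf → ℕ → ℝ) (T : OSData (QCDField Nf) 4),
          IsQCDAlong (reg.scheme m z shift) T ∧ T.IsNontrivial QCDField.glue ∧ T.IsNonGaussian QCDField.glue ∧
            (∀ f g : Fin Nf, f ≠ g → T.IsNontrivial (QCDField.pseudoRe f g)) ∧
              ∃ Δ > 0, T.HasMassGap Δ ∧ (reg.scheme m z shift).HasLatticeMassGap Δ) →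
      ∀ ε > (0 : ℝ), ∃ m : Fin Nf → ℝ, (∀ f, μ < m f) ∧ ¬ (reg.scheme m 0 0).HasLatticeMassGap ε) :
    ∀ Nf : ℕ, (Nf = 2 ∨ Nf = 3) → ∀ reg : QCDRegularisation Nf,
    reg.HasMassScaling → (∃ c : ℝ, -1 < c ∧ ∀ᶠ k in atTop, c ≤ reg.mcrit k) → ∀ μ : ℝ,
    (∀ m : Fin Nf → ℝ, (∀ f, μ < m f) →
      ∃ (z shift : QCDField Nf → ℕ → ℝ) (T : OSData (QCDField Nf) 4),
        IsQCDAlong (reg.scheme m z shift) T ∧ T.IsNontrivial QCDField.glue ∧ T.IsNonGaussian QCDField.glue ∧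
          (∀ f g : Fin Nf, f ≠ g → T.IsNontrivial (QCDField.pseudoRe f g)) ∧
            ∃ Δ > 0, T.HasMassGap Δ ∧ (reg.scheme m z shift).HasLatticeMassGap Δ) →
    (∃ ε > (0 : ℝ), ∀ m : Fin Nf → ℝ, (∀ f, μ < m f) → (reg.scheme m 0 0).HasLatticeMassGap ε) →
    ∃ δ > (0 : ℝ), ∃ ψ : ℕ → ℕ, ∃ hψ : StrictMono ψ, ∀ m : Fin Nf → ℝ, (∀ f, μ - δ < m f) →
      ∃ (z shift : QCDField Nf → ℕ → ℝ) (T : OSData (QCDField Nf) 4),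
        IsQCDAlong ((reg.restrict ψ hψ.tendsto_atTop).scheme m z shift) T ∧ T.IsNontrivial QCDField.glue ∧
          T.IsNonGaussian QCDField.glue ∧ (∀ f g : Fin Nf, f ≠ g → T.IsNontrivial (QCDField.pseudoRe f g)) ∧
            ∃ Δ > 0, T.HasMassGap Δ ∧ ((reg.restrict ψ hψ.tendsto_atTop).scheme m z shift).HasLatticeMassGap Δ := by
  intro Nf hNf reg hMS _ μ hB hG
  -- openness along the same sequence, by contraposition of H1 at `μ`
  have hopen := openness_of_gaplessInfimum
    (fun m => ∃ (z shift : QCDField Nf → ℕ → ℝ) (T : OSData (QCDField Nf) 4),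
      IsQCDAlong (reg.scheme m z shift) T ∧ T.IsNontrivial QCDField.glue ∧ T.IsNonGaussian QCDField.glue ∧
        (∀ f g : Fin Nf, f ≠ g → T.IsNontrivial (QCDField.pseudoRe f g)) ∧
          ∃ Δ > 0, T.HasMassGap Δ ∧ (reg.scheme m z shift).HasLatticeMassGap Δ)
    (fun ε m => (reg.scheme m 0 0).HasLatticeMassGap ε) (h1 Nf hNf reg hMS) μ hB hG
  obtain ⟨δ, hδ, hbelow⟩ := hopen
  refine ⟨δ, hδ, id, strictMono_id, ?_⟩
  rw [restrict_id reg strictMono_id.tendsto_atTop]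
  exact hbelow

/-- **S3 is implied by the EXISTING item `QuarksAsStableAction.MassContinuation` (stmt-QuantumFields-18327 = openness along the
same sequence, all regularisations)** — so S3 is the WEAKER form of a statement already on the ledger (take `ψ = id`). [folklore] -/
theorem subseqOpennessInterior_of_massContinuation
    (h : Summit.QuantumFields.QCD.Theses.QuarksAsStableAction.MassContinuation) :
    ∀ Nf : ℕ, (Nf = 2 ∨ Nf = 3) → ∀ reg : QCDRegularisation Nf,
    reg.HasMassScaling → (∃ c : ℝ, -1 < c ∧ ∀ᶠ k in atTop, c ≤ reg.mcrit k) → ∀ μ : ℝ,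
    (∀ m : Fin Nf → ℝ, (∀ f, μ < m f) →
      ∃ (z shift : QCDField Nf → ℕ → ℝ) (T : OSData (QCDField Nf) 4),
        IsQCDAlong (reg.scheme m z shift) T ∧ T.IsNontrivial QCDField.glue ∧ T.IsNonGaussian QCDField.glue ∧
          (∀ f g : Fin Nf, f ≠ g → T.IsNontrivial (QCDField.pseudoRe f g)) ∧
            ∃ Δ > 0, T.HasMassGap Δ ∧ (reg.scheme m z shift).HasLatticeMassGap Δ) →
    (∃ ε > (0 : ℝ), ∀ m : Fin Nf → ℝ, (∀ f, μ < m f) → (reg.scheme m 0 0).HasLatticeMassGap ε) →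
    ∃ δ > (0 : ℝ), ∃ ψ : ℕ → ℕ, ∃ hψ : StrictMono ψ, ∀ m : Fin Nf → ℝ, (∀ f, μ - δ < m f) →
      ∃ (z shift : QCDField Nf → ℕ → ℝ) (T : OSData (QCDField Nf) 4),
        IsQCDAlong ((reg.restrict ψ hψ.tendsto_atTop).scheme m z shift) T ∧ T.IsNontrivial QCDField.glue ∧
          T.IsNonGaussian QCDField.glue ∧ (∀ f g : Fin Nf, f ≠ g → T.IsNontrivial (QCDField.pseudoRe f g)) ∧
            ∃ Δ > 0, T.HasMassGap Δ ∧ ((reg.restrict ψ hψ.tendsto_atTop).scheme m z shift).HasLatticeMassGap Δ := by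
  intro Nf hNf reg hMS _ μ hB hG
  obtain ⟨ε, hε, hgap⟩ := hG
  obtain ⟨δ, hδ, hbelow⟩ := h Nf hNf reg μ ε hMS hε hB hgap
  refine ⟨δ, hδ, id, strictMono_id, ?_⟩
  rw [restrict_id reg strictMono_id.tendsto_atTop]
  exact hbelow

/-- **S4 is implied by the EXISTING item `QuarksAsStableAction.ChiralTupleGapless` (stmt-QuantumFields-18328)** — a gapless tuple
below a body that holds everywhere is a chiral offset (`μ := min_f m₀ f − 1`). [folklore] -/
theorem chiralPointOfBodyEverywhere_of_chiralTupleGapless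
    (h : Summit.QuantumFields.QCD.Theses.QuarksAsStableAction.ChiralTupleGapless) :
    ∀ Nf : ℕ, (Nf = 2 ∨ Nf = 3) → ∀ reg : QCDRegularisation Nf, reg.HasMassScaling →
      (∀ m : Fin Nf → ℝ,
        ∃ (z shift : QCDField Nf → ℕ → ℝ) (T : OSData (QCDField Nf) 4),
          IsQCDAlong (reg.scheme m z shift) T ∧ T.IsNontrivial QCDField.glue ∧ T.IsNonGaussian QCDField.glue ∧
            (∀ f g : Fin Nf, f ≠ g → T.IsNontrivial (QCDField.pseudoRe f g)) ∧
              ∃ Δ > 0, T.HasMassGap Δ ∧ (reg.scheme m z shift).HasLatticeMassGap Δ) →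
      ∃ μ : ℝ, ∀ ε > (0 : ℝ), ∃ m : Fin Nf → ℝ, (∀ f, μ < m f) ∧ ¬ (reg.scheme m 0 0).HasLatticeMassGap ε := by
  intro Nf hNf reg hMS hall
  obtain ⟨m₀, hm₀⟩ := h Nf hNf reg 0 hMS (fun m _ => hall m)
  refine ⟨-(∑ g, |m₀ g|) - 1, fun ε hε => ⟨m₀, fun f => neg_sum_abs_sub_one_lt m₀ f, hm₀ ε hε⟩⟩

/-! ## §4 The crux by name -/

/-- **The crux BY NAME, modulo the registered stubs** (saturated infimum descent): see the module docstring for the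
composition. [folklore] -/
theorem ChiralDescent_of : Summit.QuantumFields.QCD.Theses.SpectralDefectExtinction.ChiralDescent := by
  unfold Summit.QuantumFields.QCD.Theses.SpectralDefectExtinction.ChiralDescent
  rintro Nf hNf ⟨reg, hMS, M₁, -, hbody⟩
  have hNf0 : 0 < Nf := by rcases hNf with rfl | rfl <;> norm_num
  -- Step 1: an interior subsequence, or the wall.
  by_cases hint : ∃ c : ℝ, -1 < c ∧ ∃ᶠ k in atTop, c ≤ reg.mcrit k
  swap
  · exfalso
    have hwall : ∀ c : ℝ, -1 < c → ∀ᶠ k in atTop, reg.mcrit k < c := by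
      intro c hc
      have hnf : ¬ ∃ᶠ k in atTop, c ≤ reg.mcrit k := fun hf => hint ⟨c, hc, hf⟩
      simpa only [Filter.not_frequently, not_le] using hnf
    exact stub_wallNoGo Nf hNf reg hMS hwall M₁ hbody
  obtain ⟨c, hc, hfreq⟩ := hint
  obtain ⟨φ₀, hφ₀, hcφ₀⟩ := Filter.extraction_of_frequently_atTop hfreq
  -- the interior subsequence `reg₀`
  have hMS₀ : (reg.restrict φ₀ hφ₀.tendsto_atTop).HasMassScaling := hasMassScaling_restrict reg φ₀ _ hMS
  have hbody₀ := bodyAbove_restrict reg φ₀ hφ₀ M₁ hbody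
  -- Step 2: saturation over all further subsequences of `reg₀`.
  classical
  let T : (ℕ → ℕ) → Set ℝ := fun φ =>
    if h : StrictMono φ then
      {μ : ℝ | ∀ m : Fin Nf → ℝ, (∀ f, μ < m f) →
        ∃ (z shift : QCDField Nf → ℕ → ℝ) (T : OSData (QCDField Nf) 4),
          IsQCDAlong ((((reg.restrict φ₀ hφ₀.tendsto_atTop).restrict φ h.tendsto_atTop)).scheme m z shift) T ∧
            T.IsNontrivial QCDField.glue ∧ T.IsNonGaussian QCDField.glue ∧
              (∀ f g : Fin Nf, f ≠ g → T.IsNontrivial (QCDField.pseudoRe f g)) ∧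
                ∃ Δ > 0, T.HasMassGap Δ ∧
                  (((reg.restrict φ₀ hφ₀.tendsto_atTop).restrict φ h.tendsto_atTop).scheme m z shift).HasLatticeMassGap Δ}
    else ∅
  have hT : ∀ φ φ' ψ : ℕ → ℕ, StrictMono φ → StrictMono φ' → StrictMono ψ →
      (∀ᶠ k in atTop, φ' k = φ (ψ k)) → T φ ⊆ T φ' := by
    intro φ φ' ψ hφ hφ' hψ hev μ hμ
    simp only [T, dif_pos hφ, dif_pos hφ', Set.mem_setOf_eq] at hμ ⊢
    exact bodyEventualRefinement Nf _ φ φ' ψ hφ hφ' hψ hev μ hμ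
  obtain ⟨Φ, hΦ, hsat⟩ := saturation T hT
  -- the saturated regularisation `reg₁`
  set reg₁ : QCDRegularisation Nf := (reg.restrict φ₀ hφ₀.tendsto_atTop).restrict Φ hΦ.tendsto_atTop with hreg₁
  have hMS₁ : reg₁.HasMassScaling := hasMassScaling_restrict _ Φ _ hMS₀
  have hint₁ : ∃ c : ℝ, -1 < c ∧ ∀ᶠ k in atTop, c ≤ reg₁.mcrit k :=
    ⟨c, hc, Eventually.of_forall fun k => hcφ₀ (Φ k)⟩
  have hbody₁ := bodyAbove_restrict _ Φ hΦ M₁ hbody₀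
  have hTΦ : T Φ = {μ : ℝ | ∀ m : Fin Nf → ℝ, (∀ f, μ < m f) →
      ∃ (z shift : QCDField Nf → ℕ → ℝ) (T : OSData (QCDField Nf) 4),
        IsQCDAlong (reg₁.scheme m z shift) T ∧ T.IsNontrivial QCDField.glue ∧ T.IsNonGaussian QCDField.glue ∧
          (∀ f g : Fin Nf, f ≠ g → T.IsNontrivial (QCDField.pseudoRe f g)) ∧
            ∃ Δ > 0, T.HasMassGap Δ ∧ (reg₁.scheme m z shift).HasLatticeMassGap Δ} := by
    simp only [T, dif_pos hΦ, hreg₁]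
  -- Step 3: the infimum of the saturated body up-set.
  by_cases hbdd : BddBelow {μ : ℝ | ∀ m : Fin Nf → ℝ, (∀ f, μ < m f) →
      ∃ (z shift : QCDField Nf → ℕ → ℝ) (T : OSData (QCDField Nf) 4),
        IsQCDAlong (reg₁.scheme m z shift) T ∧ T.IsNontrivial QCDField.glue ∧ T.IsNonGaussian QCDField.glue ∧
          (∀ f g : Fin Nf, f ≠ g → T.IsNontrivial (QCDField.pseudoRe f g)) ∧
            ∃ Δ > 0, T.HasMassGap Δ ∧ (reg₁.scheme m z shift).HasLatticeMassGap Δ}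
  · -- bounded below: the infimum is attained and carries no uniform rate
    have hne : {μ : ℝ | ∀ m : Fin Nf → ℝ, (∀ f, μ < m f) →
      ∃ (z shift : QCDField Nf → ℕ → ℝ) (T : OSData (QCDField Nf) 4),
        IsQCDAlong (reg₁.scheme m z shift) T ∧ T.IsNontrivial QCDField.glue ∧ T.IsNonGaussian QCDField.glue ∧
          (∀ f g : Fin Nf, f ≠ g → T.IsNontrivial (QCDField.pseudoRe f g)) ∧
            ∃ Δ > 0, T.HasMassGap Δ ∧ (reg₁.scheme m z shift).HasLatticeMassGap Δ}.Nonempty := ⟨M₁, hbody₁⟩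
    have hinf := forall_above_csInf hNf0
      (fun m => ∃ (z shift : QCDField Nf → ℕ → ℝ) (T : OSData (QCDField Nf) 4),
        IsQCDAlong (reg₁.scheme m z shift) T ∧ T.IsNontrivial QCDField.glue ∧ T.IsNonGaussian QCDField.glue ∧
          (∀ f g : Fin Nf, f ≠ g → T.IsNontrivial (QCDField.pseudoRe f g)) ∧
            ∃ Δ > 0, T.HasMassGap Δ ∧ (reg₁.scheme m z shift).HasLatticeMassGap Δ) hne hbdd
    set σ : ℝ := sInf {μ : ℝ | ∀ m : Fin Nf → ℝ, (∀ f, μ < m f) →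
      ∃ (z shift : QCDField Nf → ℕ → ℝ) (T : OSData (QCDField Nf) 4),
        IsQCDAlong (reg₁.scheme m z shift) T ∧ T.IsNontrivial QCDField.glue ∧ T.IsNonGaussian QCDField.glue ∧
          (∀ f g : Fin Nf, f ≠ g → T.IsNontrivial (QCDField.pseudoRe f g)) ∧
            ∃ Δ > 0, T.HasMassGap Δ ∧ (reg₁.scheme m z shift).HasLatticeMassGap Δ} with hσ
    by_cases hG : ∃ ε > (0 : ℝ), ∀ m : Fin Nf → ℝ, (∀ f, σ < m f) → (reg₁.scheme m 0 0).HasLatticeMassGap ε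
    · exfalso
      obtain ⟨δ, hδ, ψ, hψ, hbelow⟩ := stub_subseqOpennessInterior Nf hNf reg₁ hMS₁ hint₁ σ hinf hG
      have hmem : σ - δ ∈ T (Φ ∘ ψ) := by
        have hΦψ : StrictMono (Φ ∘ ψ) := hΦ.comp hψ
        simp only [T, dif_pos hΦψ, Set.mem_setOf_eq]
        rw [hreg₁, restrict_restrict _ Φ ψ hΦ.tendsto_atTop hψ.tendsto_atTop hΦψ.tendsto_atTop] at hbelow
        exact hbelow
      obtain ⟨ν, hν, hνlt⟩ := hsat ψ hψ (σ - δ) hmem (δ / 2) (by linarith)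
      rw [hTΦ] at hν
      have hle : σ ≤ ν := csInf_le hbdd hν
      linarith
    · refine qcdOf_of_bodyAbove_of_noUniformGapAbove reg₁ hMS₁ σ hinf fun ε hε => ?_
      by_contra hno
      push Not at hno
      exact hG ⟨ε, hε, hno⟩
  · -- unbounded below: the body holds at every tuple of `reg₁`; S4 supplies the chiral offset
    have hall : ∀ m : Fin Nf → ℝ, ∃ (z shift : QCDField Nf → ℕ → ℝ) (T : OSData (QCDField Nf) 4),
        IsQCDAlong (reg₁.scheme m z shift) T ∧ T.IsNontrivial QCDField.glue ∧ T.IsNonGaussian QCDField.glue ∧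
          (∀ f g : Fin Nf, f ≠ g → T.IsNontrivial (QCDField.pseudoRe f g)) ∧
            ∃ Δ > 0, T.HasMassGap Δ ∧ (reg₁.scheme m z shift).HasLatticeMassGap Δ := by
      intro m
      rw [bddBelow_def] at hbdd
      push Not at hbdd
      obtain ⟨y, hyS, hy⟩ := hbdd (-(∑ g, |m g|) - 1)
      exact hyS m fun f => lt_trans hy (neg_sum_abs_sub_one_lt m f)
    obtain ⟨μ, hμ⟩ := stub_chiralPointOfBodyEverywhere Nf hNf reg₁ hMS₁ hall
    exact qcdOf_of_bodyAbove_of_noUniformGapAbove reg₁ hMS₁ μ (fun m _ => hall m) hμ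

end Summit.QuantumFields.QCD.Cruxes.ChiralDescent.SaturatedInfimum
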